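import Mathlib
import Literature.NumberTheory.Sieve.BatemanHornProofs
import Summits.Parity.BatemanHorn.Theorems.IsogenyRedeiPolyMobiusTailStubEventuallyTwoLe
import Summits.Parity.BatemanHorn.Theorems.PolyMobiusTail.Negative.Structure
import Literature.NumberTheory.LFunctions.PolynomialRootMoebiusShortInterval
import Summits.Parity.BatemanHorn.Theorems.IsogenyRedeiPolyMobiusTailStubStripFinOneC
import Literature.NumberTheory.LFunctions.PolynomialRootMoebiusSharpCutoff

/-!
# Crux `PolyMobiusTail` (stmt-Parity-0870), line `Sketch` (natural form): stub `stub_strip`, case `k = 1` — final file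

The registered stub `stub_strip_fin_one` of the lead's skeleton
`Summits/Parity/BatemanHorn/Cruxes/PolyMobiusTail/Lines/Sketch.lean` (the natural tail of a ONE-member
Bateman–Horn system between the cut-offs `x^{1-η}` and `x/(log x)^4` sums to `o(x)`) is proved in four
files (`…StubStripFinOne{A,B,C,}.lean`, worker of the line lead prover-line-stmt-Parity-0870-0); the
head theorem of each helper file is a registered auxiliary stub (`stub_core_fin_one`, `stub_U_identity`,
`stub_strip_fin_one_raw_bound`) so that it lands under the gate's stub-match rule.  Inputs from the tree:
Landau's theorem for `Σ μ(n)ρ_g(n)/n` in M-form with rate `(log x)^{-2}`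
(`Literature.NumberTheory.LFunctions.abs_sum_moebius_rootCount_div_le`) and the short-interval mass of
`|μρ_g|` (`…MoebiusRootCount.shortInterval_abs_moebius_mul_rootCount_le`).

This file: `strip_fin_one_of_Mform` (the stub for `k = 1` from the M-form hypothesis, assembled from
files A–C) and the registered stub `stub_strip_fin_one` itself, discharging the hypothesis by the tree's
`Literature.NumberTheory.LFunctions.abs_sum_moebius_rootCount_div_le`.
-/

open scoped BigOperators
open Filter Finset Polynomial Asymptotics

namespace Summit.Parity.BatemanHorn.Theorems.PolyMobiusTail.NaturalForm

open Literature.NumberTheory.Sieve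

namespace StripFinOne

/-- **The strip for `k = 1`, given the M-form.**  If Landau's theorem for `Σ μ(n)ρ_g(n)/n` holds in
M-function form with rate `(log x)^{-2}` for every irreducible `g` of positive degree (tree, pending:
`Literature.NumberTheory.LFunctions.abs_sum_moebius_rootCount_div_le`), then the registered `stub_strip`
holds for `k = 1`: for a one-member Bateman–Horn system and `η ∈ (1/2, 1)`, the natural tail between the
cut-offs `x^{1-η}` and `x/(log x)^4` sums to `o(x)`. [folklore] -/
theorem strip_fin_one_of_Mform
    (hM : ∀ g : ℤ[X], Irreducible g → 0 < g.natDegree → ∃ C : ℝ, ∀ x : ℝ, 2 ≤ x →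
      |∑ n ∈ Finset.Icc 1 ⌊x⌋₊, (ArithmeticFunction.moebius n : ℝ) *
          (polyRootCountMod ![g] n : ℝ) / n| ≤ C / Real.log x ^ 2) :
    ∀ (f : Fin 1 → ℤ[X]), Literature.NumberTheory.Sieve.IsBatemanHornSystem f →
      ∀ η : ℝ, 1 / 2 < η → η < 1 →
      (fun x : ℕ => ∑ n ∈ Finset.Icc 1 x,
        ((∑ d ∈ Fintype.piFinset (fun i => (((f i).eval (n : ℤ)).toNat).divisors),
            if (x : ℝ) ^ (1 - η) < ∏ i, (d i : ℝ) then
              ∏ i, ((ArithmeticFunction.moebius (d i) : ℝ) *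
                Real.log ((((f i).eval (n : ℤ)).toNat : ℝ) / (d i : ℝ))) else 0)
        - (∑ d ∈ Fintype.piFinset (fun i => (((f i).eval (n : ℤ)).toNat).divisors),
            if (x : ℝ) / Real.log x ^ (2 * 1 + 2) < ∏ i, (d i : ℝ) then
              ∏ i, ((ArithmeticFunction.moebius (d i) : ℝ) *
                Real.log ((((f i).eval (n : ℤ)).toNat : ℝ) / (d i : ℝ))) else 0)))
        =o[atTop] fun x : ℕ => (x : ℝ) := by
  intro f hf η hη1 hη2
  have hη0 : 0 < 1 - η := by linarith
  have hηpos : 0 < η := by linarith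
  -- data attached to `g = f 0`
  obtain ⟨C₁, hC₁⟩ := hM (f 0) (hf.irreducible 0) (hf.natDegree_pos 0)
  have hC₁0 : 0 ≤ C₁ := by
    have h := (abs_nonneg _).trans (hC₁ 2 le_rfl)
    have hl : 0 < Real.log (2 : ℝ) ^ 2 := pow_pos (Real.log_pos (by norm_num)) 2
    by_contra hneg
    have : C₁ / Real.log 2 ^ 2 < 0 := div_neg_of_neg_of_pos (by linarith) hl
    linarith
  obtain ⟨A, hA0, hA⟩ := sum_abs_moebius_mul_rootCount_le (hf.irreducible 0) (hf.natDegree_pos 0)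
  obtain ⟨N₀, hN₀3, h2, hmono⟩ := threshold_fin_one hf
  obtain ⟨K, hK⟩ := log_toNat_eval_le (f 0)
  set B₀ : ℝ := ∑ n ∈ range N₀, 2 * ∑ e ∈ (((f 0).eval (n : ℤ)).toNat).divisors,
      |(ArithmeticFunction.moebius e : ℝ) * Real.log (((((f 0).eval (n : ℤ)).toNat : ℕ) : ℝ) / (e : ℝ))|
    with hB₀
  set Ctot : ℝ := 4 * K * A + 4 * A + (K : ℝ) * (4 * C₁ + C₁ / (1 - η) ^ 2) + 10 * C₁ / (1 - η)
    with hCtot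
  refine IsBigO.trans_isLittleO ?_ (isLittleO_const_add_mul_div_log B₀ Ctot)
  refine IsBigO.of_bound 1 ?_
  have hE1 : ∀ᶠ x : ℕ in atTop, (4 : ℝ) ≤ (x : ℝ) ^ (1 - η) :=
    ((tendsto_rpow_atTop hη0).comp tendsto_natCast_atTop_atTop).eventually_ge_atTop 4
  filter_upwards [eventually_ge_atTop N₀, hE1, eventually_log_pow_four_le_rpow hηpos,
    eventually_log_pow_four_le_rpow (by norm_num : (0 : ℝ) < 1 / 2)] with x hxN h4 hE2 hE3
  rw [one_mul, Real.norm_eq_abs, Real.norm_eq_abs]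
  -- the two cut-offs
  have hx3 : 3 ≤ x := hN₀3.trans hxN
  have hx0 : (0 : ℝ) < x := by exact_mod_cast (by omega : 0 < x)
  have hL1 : 1 ≤ Real.log x := by
    rw [Real.le_log_iff_exp_le hx0]
    have : (3 : ℝ) ≤ x := by exact_mod_cast hx3
    linarith [Real.exp_one_lt_d9]
  have hL0 : 0 < Real.log x := by linarith
  set L := Real.log x with hL
  set y₁ : ℝ := (x : ℝ) ^ (1 - η) with hy₁
  set y₂ : ℝ := (x : ℝ) / L ^ (2 * 1 + 2) with hy₂
  have hy₂' : y₂ = (x : ℝ) / L ^ 4 := by rw [hy₂]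
  have hL4 : 1 ≤ L ^ 4 := one_le_pow₀ hL1
  have hL4pos : 0 < L ^ 4 := by positivity
  have hlogy₁ : Real.log y₁ = (1 - η) * L := by rw [hy₁, Real.log_rpow hx0]
  have h12 : y₁ ≤ y₂ := by
    rw [hy₂', le_div_iff₀ hL4pos]
    calc y₁ * L ^ 4 ≤ (x : ℝ) ^ (1 - η) * (x : ℝ) ^ η :=
          mul_le_mul_of_nonneg_left hE2 (Real.rpow_nonneg hx0.le _)
      _ = x := by rw [← Real.rpow_add hx0]; norm_num
  have h2x : y₂ ≤ x := by
    rw [hy₂']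
    exact div_le_self hx0.le hL4
  have hsqrt_le : (x : ℝ) ^ (1 / 2 : ℝ) ≤ y₂ := by
    rw [hy₂', le_div_iff₀ hL4pos]
    calc (x : ℝ) ^ (1 / 2 : ℝ) * L ^ 4 ≤ (x : ℝ) ^ (1 / 2 : ℝ) * (x : ℝ) ^ (1 / 2 : ℝ) :=
          mul_le_mul_of_nonneg_left hE3 (Real.rpow_nonneg hx0.le _)
      _ = x := by rw [← Real.rpow_add hx0]; norm_num
  have hy₂pos : 0 < y₂ := lt_of_lt_of_le (Real.rpow_pos_of_pos hx0 _) hsqrt_le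
  have hlogy₂ : L / 2 ≤ Real.log y₂ := by
    have h := Real.log_le_log (Real.rpow_pos_of_pos hx0 _) hsqrt_le
    rw [Real.log_rpow hx0] at h
    linarith
  have hlogy₂le : Real.log y₂ ≤ L := Real.log_le_log hy₂pos h2x
  have hy₁4 : (4 : ℝ) ≤ y₁ := h4
  have hlogy₁le : Real.log y₁ ≤ L := Real.log_le_log (by linarith) (h12.trans h2x)
  -- `⌊y₁⌋ ≥ √y₁`, so `log ⌊y₁⌋ ≥ (1-η) L / 2`
  have hfloor : (1 - η) * L / 2 ≤ Real.log (⌊y₁⌋₊ : ℝ) := by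
    have hs : Real.sqrt y₁ ≤ (⌊y₁⌋₊ : ℝ) := by
      have hfl : y₁ - 1 ≤ (⌊y₁⌋₊ : ℝ) := by
        have := Nat.lt_floor_add_one y₁
        linarith
      refine le_trans ?_ hfl
      rw [Real.sqrt_le_left (by linarith)]
      nlinarith
    have hs0 : 0 < Real.sqrt y₁ := Real.sqrt_pos.mpr (by linarith)
    have h := Real.log_le_log hs0 hs
    rw [Real.log_sqrt (by linarith), hlogy₁] at h
    linarith
  have hfloorpos : 0 < Real.log (⌊y₁⌋₊ : ℝ) := lt_of_lt_of_le (by positivity) hfloor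
  -- reduce to divisor sums of `g = f 0`, split off `n < N₀`, apply the raw bound
  have hsum : ∀ n : ℕ,
      ((∑ d ∈ Fintype.piFinset (fun i => (((f i).eval (n : ℤ)).toNat).divisors),
          if y₁ < ∏ i, (d i : ℝ) then
            ∏ i, ((ArithmeticFunction.moebius (d i) : ℝ) *
              Real.log ((((f i).eval (n : ℤ)).toNat : ℝ) / (d i : ℝ))) else 0)
        - (∑ d ∈ Fintype.piFinset (fun i => (((f i).eval (n : ℤ)).toNat).divisors),
          if y₂ < ∏ i, (d i : ℝ) then
            ∏ i, ((ArithmeticFunction.moebius (d i) : ℝ) *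
              Real.log ((((f i).eval (n : ℤ)).toNat : ℝ) / (d i : ℝ))) else 0))
      = ((∑ e ∈ (((f 0).eval (n : ℤ)).toNat).divisors, if y₁ < (e : ℝ) then
          (ArithmeticFunction.moebius e : ℝ) *
            Real.log (((((f 0).eval (n : ℤ)).toNat : ℕ) : ℝ) / (e : ℝ)) else 0)
        - (∑ e ∈ (((f 0).eval (n : ℤ)).toNat).divisors, if y₂ < (e : ℝ) then
          (ArithmeticFunction.moebius e : ℝ) *
            Real.log (((((f 0).eval (n : ℤ)).toNat : ℕ) : ℝ) / (e : ℝ)) else 0)) := by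
    intro n
    rw [tail_fin_one, tail_fin_one]
  rw [Finset.sum_congr rfl fun n _ => hsum n]
  rw [← Finset.sum_filter_add_sum_filter_not (Icc 1 x) (fun n => n < N₀)]
  have hIcc : (Icc 1 x).filter (fun n => ¬n < N₀) = Icc N₀ x := by
    ext n
    simp only [Finset.mem_filter, mem_Icc, not_lt]
    omega
  rw [hIcc]
  have hinit := initial_fin_one (f 0) N₀ x y₁ y₂
  have hraw := stub_strip_fin_one_raw_bound (f 0) hN₀3 h2 hmono hK hA0 hA hC₁0 hC₁ hxN hy₁4 h12 h2x
  -- convert the raw bound into `Ctot · x / log x`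
  have hKL0 : 0 ≤ (K : ℝ) * L := by positivity
  have hLy₂ : L * y₂ ≤ (x : ℝ) / L := by
    have h1 : L * y₂ = (x : ℝ) / L ^ 3 := by
      rw [hy₂']
      field_simp
    rw [h1]
    exact div_le_div_of_nonneg_left hx0.le hL0 (le_self_pow₀ hL1 (by norm_num))
  have hy₁0 : 0 ≤ y₁ := by linarith
  have hy₂0 : 0 ≤ y₂ := hy₂pos.le
  have hAy₂ : 0 ≤ A * y₂ := mul_nonneg hA0 hy₂0
  have hAy₁ : 0 ≤ A * y₁ := mul_nonneg hA0 hy₁0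
  have hAy₁₂ : A * y₁ ≤ A * y₂ := mul_le_mul_of_nonneg_left h12 hA0
  have hT1 : 2 * ((K : ℝ) * L) * (A * y₂) + 2 * ((K : ℝ) * L) * (A * y₁) ≤ 4 * K * A * ((x : ℝ) / L) := by
    have h1 : 2 * ((K : ℝ) * L) * (A * y₁) ≤ 2 * ((K : ℝ) * L) * (A * y₂) :=
      mul_le_mul_of_nonneg_left hAy₁₂ (by positivity)
    have h2' : 4 * ((K : ℝ) * L) * (A * y₂) = 4 * K * A * (L * y₂) := by ring
    have h3 : 4 * (K : ℝ) * A * (L * y₂) ≤ 4 * K * A * ((x : ℝ) / L) :=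
      mul_le_mul_of_nonneg_left hLy₂ (by positivity)
    linarith
  have hT3 : 2 * (Real.log y₂ * (A * y₂)) + 2 * (Real.log y₁ * (A * y₁)) ≤ 4 * A * ((x : ℝ) / L) := by
    have h1 : Real.log y₂ * (A * y₂) ≤ L * (A * y₂) := mul_le_mul_of_nonneg_right hlogy₂le hAy₂
    have h2' : Real.log y₁ * (A * y₁) ≤ L * (A * y₁) := mul_le_mul_of_nonneg_right hlogy₁le hAy₁
    have h3 : L * (A * y₁) ≤ L * (A * y₂) := mul_le_mul_of_nonneg_left hAy₁₂ hL0.le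
    have h4' : 4 * (L * (A * y₂)) = 4 * A * (L * y₂) := by ring
    have h5 : 4 * A * (L * y₂) ≤ 4 * A * ((x : ℝ) / L) := mul_le_mul_of_nonneg_left hLy₂ (by positivity)
    linarith
  have hT2 : ((x : ℝ) * ((K : ℝ) * L)) * (C₁ / Real.log y₂ ^ 2 + C₁ / Real.log y₁ ^ 2)
      ≤ (K : ℝ) * (4 * C₁ + C₁ / (1 - η) ^ 2) * ((x : ℝ) / L) := by
    have hly₂pos : 0 < Real.log y₂ := lt_of_lt_of_le (by positivity) hlogy₂
    have ha : C₁ / Real.log y₂ ^ 2 ≤ C₁ / (L / 2) ^ 2 :=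
      div_le_div_of_nonneg_left hC₁0 (by positivity) (pow_le_pow_left₀ (by positivity) hlogy₂ 2)
    have hb : C₁ / Real.log y₁ ^ 2 = C₁ / ((1 - η) * L) ^ 2 := by rw [hlogy₁]
    calc ((x : ℝ) * ((K : ℝ) * L)) * (C₁ / Real.log y₂ ^ 2 + C₁ / Real.log y₁ ^ 2)
        ≤ ((x : ℝ) * ((K : ℝ) * L)) * (C₁ / (L / 2) ^ 2 + C₁ / ((1 - η) * L) ^ 2) := by
          rw [hb]
          exact mul_le_mul_of_nonneg_left (add_le_add ha le_rfl) (by positivity)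
      _ = (K : ℝ) * (4 * C₁ + C₁ / (1 - η) ^ 2) * ((x : ℝ) / L) := by
          field_simp
          ring
  have hT4 : (x : ℝ) * (5 * C₁ / Real.log (⌊y₁⌋₊ : ℝ)) ≤ 10 * C₁ / (1 - η) * ((x : ℝ) / L) := by
    have ha : 5 * C₁ / Real.log (⌊y₁⌋₊ : ℝ) ≤ 5 * C₁ / ((1 - η) * L / 2) :=
      div_le_div_of_nonneg_left (by positivity) (by positivity) hfloor
    calc (x : ℝ) * (5 * C₁ / Real.log (⌊y₁⌋₊ : ℝ)) ≤ (x : ℝ) * (5 * C₁ / ((1 - η) * L / 2)) :=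
          mul_le_mul_of_nonneg_left ha hx0.le
      _ = 10 * C₁ / (1 - η) * ((x : ℝ) / L) := by
          field_simp
          ring
  have hmainle : 2 * ((K : ℝ) * L) * (A * y₂) + 2 * ((K : ℝ) * L) * (A * y₁)
        + ((x : ℝ) * ((K : ℝ) * L)) * (C₁ / Real.log y₂ ^ 2 + C₁ / Real.log y₁ ^ 2)
        + 2 * (Real.log y₂ * (A * y₂)) + 2 * (Real.log y₁ * (A * y₁))
        + (x : ℝ) * (5 * C₁ / Real.log (⌊y₁⌋₊ : ℝ)) ≤ Ctot * ((x : ℝ) / L) := by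
    have hC : Ctot * ((x : ℝ) / L) = 4 * K * A * ((x : ℝ) / L) + 4 * A * ((x : ℝ) / L)
        + (K : ℝ) * (4 * C₁ + C₁ / (1 - η) ^ 2) * ((x : ℝ) / L)
        + 10 * C₁ / (1 - η) * ((x : ℝ) / L) := by
      rw [hCtot]
      ring
    rw [hC]
    linarith
  have hB₀0 : 0 ≤ B₀ := Finset.sum_nonneg fun n _ =>
    mul_nonneg zero_le_two (Finset.sum_nonneg fun e _ => abs_nonneg _)
  calc _ ≤ |∑ n ∈ (Icc 1 x).filter (fun n => n < N₀),
          ((∑ e ∈ (((f 0).eval (n : ℤ)).toNat).divisors, if y₁ < (e : ℝ) then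
            (ArithmeticFunction.moebius e : ℝ) *
              Real.log (((((f 0).eval (n : ℤ)).toNat : ℕ) : ℝ) / (e : ℝ)) else 0)
          - (∑ e ∈ (((f 0).eval (n : ℤ)).toNat).divisors, if y₂ < (e : ℝ) then
            (ArithmeticFunction.moebius e : ℝ) *
              Real.log (((((f 0).eval (n : ℤ)).toNat : ℕ) : ℝ) / (e : ℝ)) else 0))|
        + |∑ n ∈ Icc N₀ x,
          ((∑ e ∈ (((f 0).eval (n : ℤ)).toNat).divisors, if y₁ < (e : ℝ) then
            (ArithmeticFunction.moebius e : ℝ) *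
              Real.log (((((f 0).eval (n : ℤ)).toNat : ℕ) : ℝ) / (e : ℝ)) else 0)
          - (∑ e ∈ (((f 0).eval (n : ℤ)).toNat).divisors, if y₂ < (e : ℝ) then
            (ArithmeticFunction.moebius e : ℝ) *
              Real.log (((((f 0).eval (n : ℤ)).toNat : ℕ) : ℝ) / (e : ℝ)) else 0))| := abs_add_le _ _
    _ ≤ B₀ + Ctot * ((x : ℝ) / L) := add_le_add hinit (hraw.trans hmainle)
    _ ≤ |B₀ + Ctot * ((x : ℝ) / L)| := le_abs_self _

end StripFinOne

/-- **Stub `stub_strip_fin_one`** (the registered `stub_strip` at `k = 1`): for a one-member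
Bateman–Horn system and `η ∈ (1/2, 1)`, the natural tail between the cut-offs `x^{1-η}` and `x/(log x)^4`
sums to `o(x)`. -/
theorem stub_strip_fin_one : ∀ (f : Fin 1 → ℤ[X]),
    Literature.NumberTheory.Sieve.IsBatemanHornSystem f → ∀ η : ℝ, 1 / 2 < η → η < 1 →
      (fun x : ℕ => ∑ n ∈ Finset.Icc 1 x,
        ((∑ d ∈ Fintype.piFinset (fun i => (((f i).eval (n : ℤ)).toNat).divisors),
            if (x : ℝ) ^ (1 - η) < ∏ i, (d i : ℝ) then
              ∏ i, ((ArithmeticFunction.moebius (d i) : ℝ) *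
                Real.log ((((f i).eval (n : ℤ)).toNat : ℝ) / (d i : ℝ))) else 0)
        - (∑ d ∈ Fintype.piFinset (fun i => (((f i).eval (n : ℤ)).toNat).divisors),
            if (x : ℝ) / Real.log x ^ (2 * 1 + 2) < ∏ i, (d i : ℝ) then
              ∏ i, ((ArithmeticFunction.moebius (d i) : ℝ) *
                Real.log ((((f i).eval (n : ℤ)).toNat : ℝ) / (d i : ℝ))) else 0)))
        =o[atTop] fun x : ℕ => (x : ℝ) :=
  StripFinOne.strip_fin_one_of_Mform fun _ hi hd =>
    Literature.NumberTheory.LFunctions.abs_sum_moebius_rootCount_div_le hi hd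

end Summit.Parity.BatemanHorn.Theorems.PolyMobiusTail.NaturalForm
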